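/-
PORT (pub-hodgecm2, COR-CM cell), part 2/2 of the stage-1 package file `HodgeCMPerL/HodgeCM/Proofs/Prop22/Algebraic.lean`
(md5 d0621a315e9e, 491 lines; split mechanically at top-level declaration boundaries because tree files are
≤ 400 lines; the enclosing namespaces/sections/variables are re-opened verbatim). Declarations VERBATIM; edits as in part 1.
-/
import Summits.HodgeConjecture.CorCM.Proofs.Prop22.Algebraic1

/-!
# `Proofs/Prop22/Algebraic.lean` — part 2/2 (continued)

Continuation of `Summits.HodgeConjecture.CorCM.Proofs.Prop22.Algebraic1`: the stage-1 package file
`HodgeCM/Proofs/Prop22/Algebraic.lean` is split mechanically at top-level declaration boundaries (tree files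
are ≤ 400 lines); the enclosing namespaces, sections, `variable`s and `open`s are re-opened exactly as they
stand at the cut. See part 1 for the mathematical module docstring (rfwf Prop 2.2, Steps E–F: this part
carries the irreducible-module lemma `submodule_le_of_cyclic`, the `G`-argument `exists_weil_alg_ne_zero`
and the conclusion `weilLine_le_alg_of_detect`).
-/

noncomputable section

open scoped TensorProduct NumberField IntermediateField


namespace Summit.HodgeConjecture.CorCM

open Literature.AlgebraicGeometry.Motives
open Literature.AlgebraicGeometry.Motives.HodgeStructure (EndAction conj ofRat conj_baseChange conj_smul
  conj_conj conj_tmul)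
open Literature.NumberTheory.Automorphic (cmConjRingHom embedding_cmConjRingHom)
open NumberField (RingOfIntegers)
open NumberField.ComplexEmbedding (conjugate)
open Polynomial


namespace Universe

variable {U : Universe}


section detect

variable (K : CMField) (Φ : Fin 4 → CMType K)

variable {K Φ}


omit U in
/-- Irreducible-module argument: a `T`-stable subspace `W` with `dim W = deg m`, `m` irreducible and `m(T)` killing `W`, is contained in any `T`-stable `A` meeting it non-trivially. -/
theorem submodule_le_of_cyclic {V : Type*} [AddCommGroup V] [Module ℚ V] [FiniteDimensional ℚ V]
    (W A : Submodule ℚ V) (T : V →ₗ[ℚ] V) (m : ℚ[X]) (hm : Irreducible m)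
    (hdeg : m.natDegree = Module.finrank ℚ W)
    (hW : ∀ w ∈ W, T w ∈ W) (hA : ∀ v ∈ A, T v ∈ A) (hkill : ∀ w ∈ W, aeval T m w = 0)
    (x : V) (hxW : x ∈ W) (hxA : x ∈ A) (hx : x ≠ 0) : W ≤ A := by
  set n := m.natDegree with hn
  -- the orbit map `q ↦ q(T) x` on polynomials of degree `< n`
  let ev : Polynomial.degreeLT ℚ n →ₗ[ℚ] V :=
    (LinearMap.applyₗ x).comp ((aeval T).toLinearMap.comp (Polynomial.degreeLT ℚ n).subtype)
  have hev : ∀ q, ev q = aeval T (q : ℚ[X]) x := fun q => rfl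
  have hinj : Function.Injective ev := by
    rw [← LinearMap.ker_eq_bot, Submodule.eq_bot_iff]
    intro q hq
    rw [LinearMap.mem_ker, hev] at hq
    by_contra hq0
    have hq0' : (q : ℚ[X]) ≠ 0 := fun h => hq0 (Subtype.ext h)
    have hlt : (q : ℚ[X]).natDegree < n := by
      have := Polynomial.mem_degreeLT.mp q.2
      exact (Polynomial.natDegree_lt_iff_degree_lt hq0').mpr this
    have hndvd : ¬ m ∣ (q : ℚ[X]) := fun hd => by
      have := Polynomial.natDegree_le_of_dvd hd hq0'
      omega
    obtain ⟨a, c, hac⟩ := (hm.coprime_iff_not_dvd.mpr hndvd)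
    have : x = 0 := by
      have h1 := congrArg (fun r => aeval T r x) hac
      simp only [map_add, map_mul, map_one, LinearMap.add_apply, Module.End.mul_apply, Module.End.one_apply,
        hkill x hxW, hq, map_zero, add_zero] at h1
      exact h1.symm
    exact hx this
  have hrange_le : LinearMap.range ev ≤ W := by
    rintro _ ⟨q, rfl⟩
    exact aeval_apply_mem W T hW _ x hxW
  have hrank : Module.finrank ℚ (LinearMap.range ev) = n := by
    rw [LinearMap.finrank_range_of_inj hinj, (Polynomial.degreeLTEquiv ℚ n).finrank_eq,
      Module.finrank_fin_fun]
  have heq : LinearMap.range ev = W :=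
    Submodule.eq_of_le_of_finrank_le hrange_le (by rw [hrank]; omega)
  intro w hw
  rw [← heq] at hw
  obtain ⟨q, rfl⟩ := hw
  exact aeval_apply_mem A T hA _ x hxA

/-! ### Step F (ii): a nonzero algebraic Weil class from the detected one -/

omit U in
/-- if `g ∘ T = μ g` then `g ∘ u(T) = u(μ) g` -/
theorem comp_aeval_of_comp_eq_smul {V : Type*} [AddCommGroup V] [Module ℚ V] (g : V →ₗ[ℚ] ℂ) (T : V →ₗ[ℚ] V)
    (μ : ℂ) (h : g ∘ₗ T = μ • g) (u : ℚ[X]) : g ∘ₗ aeval T u = (aeval μ u) • g := by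
  have hk : ∀ k : ℕ, g ∘ₗ T ^ k = μ ^ k • g := by
    intro k
    induction k with
    | zero => rw [pow_zero, pow_zero, one_smul, Module.End.one_eq_id, LinearMap.comp_id]
    | succ k ih =>
      rw [pow_succ, Module.End.mul_eq_comp, ← LinearMap.comp_assoc, ih, LinearMap.smul_comp, h, smul_smul,
        ← pow_succ]
  induction u using Polynomial.induction_on' with
  | add p q hp hq => rw [map_add, LinearMap.comp_add, hp, hq, map_add, add_smul]
  | monomial k a =>
    rw [aeval_monomial, aeval_monomial, Algebra.algebraMap_eq_smul_one, Algebra.algebraMap_eq_smul_one,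
      smul_mul_assoc, smul_mul_assoc, one_mul, one_mul, LinearMap.comp_smul, hk, smul_assoc]

/-- **The `G`-argument.** If a Weil generator `y` of eigencharacter `σ` pairs non-trivially with an
algebraic class `z ∈ Alg^{d-2}(P)`, then `W_K(P) ∩ Alg²(P) ≠ 0`. -/
theorem exists_weil_alg_ne_zero (M : U.ModelAxioms) (σ : K →+* ℂ) (c : (i : Fin 4) → U.CohC (U.cmAV K (Φ i)) 1)
    (hc : ∀ i, c i ∈ U.eigenLine K (Φ i) σ)
    (z : U.Coh (U.prod4 K Φ) (2 * (U.dim (U.prod4 K Φ) - 2))) (hz : z ∈ U.alg _ (U.dim (U.prod4 K Φ) - 2))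
    (hne : U.Bc K Φ (U.weilGen K Φ c) z ≠ 0) :
    ∃ x ∈ U.weilLine K Φ, x ∈ U.alg (U.prod4 K Φ) 2 ∧ x ≠ 0 := by
  classical
  obtain ⟨b, hb0, hsep⟩ := exists_separating K
  -- the conjugate integer `b̄` and the two diagonal actions
  let bb : 𝓞 K := ⟨cmConjRingHom K b, map_isIntegral_int (cmConjRingHom K) b.isIntegral_coe⟩
  have hbb : (bb : K) = cmConjRingHom K b := rfl
  have hconj : cmConjRingHom K (bb : K) = b := by
    rw [hbb]; apply σ.injective; rw [embedding_cmConjRingHom, embedding_cmConjRingHom, starRingEnd_self_apply]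
  have hbb0 : (bb : K) ≠ 0 := by rw [hbb]; exact (map_ne_zero (cmConjRingHom K)).mpr hb0
  obtain ⟨Mb, hMb⟩ := U.exists_diagAct M K Φ b
  obtain ⟨Mbb, hMbb⟩ := U.exists_diagAct M K Φ bb
  obtain ⟨D, hDbij, hDalg, hDeq⟩ := M.algDuality K Φ
  have hequiv := hDeq (bb : K) Mbb Mb hMbb (by rw [hconj]; exact hMb)
  set T := U.pull Mb 4 with hT
  set T' := U.pull Mbb (2 * (U.dim (U.prod4 K Φ) - 2)) with hT'
  have hN0 : Algebra.norm ℚ (bb : K) ≠ 0 := Algebra.norm_ne_zero_iff.mpr hbb0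
  have hTDT' : ∀ z₀, T (D (T' z₀)) = (Algebra.norm ℚ (bb : K) ^ 4) • D z₀ := fun z₀ => by
    have := LinearMap.congr_fun hequiv z₀
    simpa only [LinearMap.comp_apply, LinearMap.smul_apply] using this
  have hT'inj : Function.Injective T' := by
    intro z₁ z₂ h12
    have h' : (Algebra.norm ℚ (bb : K) ^ 4) • D z₁ = (Algebra.norm ℚ (bb : K) ^ 4) • D z₂ := by
      rw [← hTDT', ← hTDT', h12]
    exact hDbij.1 (smul_right_injective _ (pow_ne_zero 4 hN0) h')
  have hT'surj : Function.Surjective T' := LinearMap.surjective_of_injective hT'inj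
  -- polynomials in `T`: `m χ_T = mⁿ r`, Bézout `s mⁿ + t r = 1`
  set m := minpoly ℚ ((b : K) ^ 4) with hm
  have hint : IsIntegral ℚ ((b : K) ^ 4) := Algebra.IsIntegral.isIntegral _
  have hm_irr : Irreducible m := minpoly.irreducible hint
  have hPi0 : m * T.charpoly ≠ 0 := mul_ne_zero (minpoly.ne_zero hint) (LinearMap.charpoly_monic T).ne_zero
  obtain ⟨n, r, hndvd, hfac⟩ := WfDvdMonoid.max_power_factor hPi0 hm_irr
  have hn : n ≠ 0 := by
    rintro rfl
    apply hndvd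
    rw [pow_zero, one_mul] at hfac
    rw [← hfac]; exact dvd_mul_right m _
  have hcop : IsCoprime (m ^ n) r := (hm_irr.coprime_iff_not_dvd.mpr hndvd).pow_left
  obtain ⟨s, t, hst⟩ := hcop
  have hPiT : aeval T (m * T.charpoly) = 0 := by rw [map_mul, LinearMap.aeval_self_charpoly, mul_zero]
  -- the candidate class `x = (t r)(T) (D z)`
  have hx₁A : D z ∈ U.alg (U.prod4 K Φ) 2 := hDalg ⟨z, hz, rfl⟩
  refine ⟨aeval T (t * r) (D z), ?_, ?_, ?_⟩
  · apply U.ker_le_weilLine M hsep hMb n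
    rw [← Module.End.mul_apply, ← map_mul, show m ^ n * (t * r) = t * (m * T.charpoly) by rw [hfac]; ring,
      map_mul, hPiT, mul_zero, LinearMap.zero_apply]
  · exact aeval_apply_mem _ T (U.pull_mem_alg2 M) _ _ hx₁A
  · -- non-vanishing, via the functional `g(v) = B(y, D⁻¹ v)`
    intro hx0
    let De := LinearEquiv.ofBijective D hDbij
    have hDe : ∀ v, D (De.symm v) = v := fun v => De.apply_symm_apply v
    have hDe' : ∀ z₀, De.symm (D z₀) = z₀ := fun z₀ => De.symm_apply_apply z₀
    set y := U.weilGen K Φ c with hy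
    let g : U.Coh (U.prod4 K Φ) 4 →ₗ[ℚ] ℂ :=
      { toFun := fun v => U.Bc K Φ y (De.symm v)
        map_add' := fun v v' => by simp only [map_add, Bc_add_right]
        map_smul' := fun q v => by simp only [map_smul, Bc_smul_right, RingHom.id_apply, Rat.smul_def] }
    have hg : ∀ v, g v = U.Bc K Φ y (De.symm v) := fun v => rfl
    set μ : ℂ := σ (bb : K) ^ 4 with hμ
    have hyT : U.pullC Mbb 4 y = μ • y := pullC_weilGen_eigen M hMbb hc
    have hgT : g ∘ₗ T = μ • g := by
      ext v
      obtain ⟨z₀, hz₀⟩ := hT'surj (De.symm v)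
      have hadj := U.Bc_pull_pull M hMbb y z₀
      rw [hyT, Bc_smul_left] at hadj
      rw [LinearMap.comp_apply, LinearMap.smul_apply, hg, hg]
      conv_lhs => rw [← hDe v]
      rw [← hz₀, hTDT' z₀, map_smul, hDe', Bc_smul_right, smul_eq_mul, hadj]
    have hgpoly := comp_aeval_of_comp_eq_smul g T μ hgT
    have hμm : aeval μ m = 0 := by
      have : μ = (conjugate σ).toRatAlgHom ((b : K) ^ 4) := by
        show σ (bb : K) ^ 4 = conjugate σ ((b : K) ^ 4)
        rw [map_pow, NumberField.ComplexEmbedding.conjugate_coe_eq, hbb, embedding_cmConjRingHom]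
      rw [this, aeval_algHom_apply, minpoly.aeval, map_zero]
    have hdec : D z = aeval T (s * m ^ n) (D z) + aeval T (t * r) (D z) := by
      rw [← LinearMap.add_apply, ← map_add, hst, map_one, Module.End.one_apply]
    have h1 : g (D z) = U.Bc K Φ y z := by rw [hg, hDe']
    have h2 : g (aeval T (s * m ^ n) (D z)) = 0 := by
      have := LinearMap.congr_fun (hgpoly (s * m ^ n)) (D z)
      rw [LinearMap.comp_apply, LinearMap.smul_apply] at this
      rw [this, map_mul, map_pow, hμm, zero_pow hn, mul_zero, zero_smul]
    have : U.Bc K Φ y z = 0 := by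
      rw [← h1, hdec, map_add, h2, hx0, map_zero, add_zero]
    exact hne this

/-- **Steps E–F of rfwf Prop 2.2**: one detected Weil class makes the whole Weil line algebraic. -/
theorem weilLine_le_alg_of_detect (M : U.ModelAxioms) (σ : K →+* ℂ) (c : (i : Fin 4) → U.CohC (U.cmAV K (Φ i)) 1)
    (hc : ∀ i, c i ∈ U.eigenLine K (Φ i) σ)
    (z : U.Coh (U.prod4 K Φ) (2 * (U.dim (U.prod4 K Φ) - 2))) (hz : z ∈ U.alg _ (U.dim (U.prod4 K Φ) - 2))
    (hne : U.Bc K Φ (U.weilGen K Φ c) z ≠ 0) :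
    U.weilLine K Φ ≤ U.alg (U.prod4 K Φ) 2 := by
  obtain ⟨x, hxW, hxA, hx⟩ := U.exists_weil_alg_ne_zero M σ c hc z hz hne
  obtain ⟨b, hb0, hsep⟩ := exists_separating K
  obtain ⟨Mb, hMb⟩ := U.exists_diagAct M K Φ b
  refine submodule_le_of_cyclic (U.weilLine K Φ) (U.alg (U.prod4 K Φ) 2) (U.pull Mb 4)
    (minpoly ℚ ((b : K) ^ 4)) (minpoly.irreducible (Algebra.IsIntegral.isIntegral _)) ?_
    (U.weilLine_stable M hMb) (U.pull_mem_alg2 M) (U.weilLine_killed M hMb) x hxW hxA hx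
  rw [natDegree_minpoly_pow_four hsep, M.weilLine_rank K Φ]

end detect

end Universe

end Summit.HodgeConjecture.CorCM

end
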